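import Summits.CriticalPhenomena.PercolationContinuityZ3.Theorems.Transplant.SkelFrmQuasiBParamsBridgeF
import Summits.CriticalPhenomena.PercolationContinuityZ3.Theorems.Transplant.SkelFrmBParamsBridgeF
import Summits.CriticalPhenomena.PercolationContinuityZ3.Theorems.Transplant.PlanarSkeletonFrmQuasiDefs
import Summits.CriticalPhenomena.PercolationContinuityZ3.Theorems.Transplant.PlanarSkeletonFrmDefs
import Summits.CriticalPhenomena.PercolationContinuityZ3.Theorems.Transplant.SkelPhiStepIDataNS
import Summits.CriticalPhenomena.PercolationContinuityZ3.Theorems.Transplant.SkelFrmQuasi1ParamsLBL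
import Summits.CriticalPhenomena.PercolationContinuityZ3.Theorems.Transplant.SkelFrmQuasiBChoiceNums
import Summits.CriticalPhenomena.PercolationContinuityZ3.Theorems.Transplant.SkelFrmQuasiBParamsLF
import HarnessLib
import Summits.CriticalPhenomena.PercolationContinuityZ3.Theorems.Transplant.SkelFrmBParamsClearF
/-!
# GEN-Q PORT (WAVE-Q table v0.8 section 2, row G111, U-level L14; captain R-6/R-7 2026-08-27: carrier token swap `PlanarSkeletonFrmFrom ↦ PlanarSkeletonFrmQuasi`)
# of the tree module «Transplant/SkelFrmFromBParamsClearF» (sha256 cc0f9073ae61c72c…) onto the quasi-step carrier `PlanarSkeletonFrmQuasi` (p507026): «SkelFrmQuasiBParamsClearF»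

ORIGINAL TITLE: (F) VALUE LAYER, N2 twin (hp-8 g42, 2026-08-23; F-DISCHARGE-MAP-N2 G8/(Δ3)): `port_frm.py` text of N1 `SkelNegBParamsClearF` (stmt-g16) over the N2 wide bridge pair

builds on p205010 (kernel theorem, internal audit signed; external expert review pending) — nothing in this file uses p205010; NOTHING is claimed about any open node
((N3-b), the end state).  Lane `prim-bschramm`, seat `prim-bschramm-p3` (gen 30; design owner; tool = captain gen-1 g4's port_genq.py R-14 --cone + p3-g30 slot-value patch T1).  Helper file (`--supports stmt-CriticalPhenomena-4575 --as helper`).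
PORT RULES (U-wave r1–r4 re-used, GEN-Q hunk classes of p3-g29 #6136): declaration order, names and proof texts are those of «SkelFrmFromBParamsClearF», byte-identical except
(i) the carrier token `PlanarSkeletonFrmFrom ↦ PlanarSkeletonFrmQuasi` in binders, `namespace`/`end` lines and qualified names (module names `SkelFrmFrom… ↦ SkelFrmQuasi…`
in imports of already-ported rows); (ii) `Φ.step ↦ Φ.qstep` with the called Steps lemma replaced by its `…Q`/`_q` twin and the cost `Φ.M` threaded (none in this file unless
listed below); (iii) `Φ.cyl_connected ↦ Φ.cyl_reach` readers (none unless listed); (iv) graph-ball radii / window floors ×`Φ.M` (none unless listed); (v) L-KitS-1 (design-owner ruling 2026-08-27): the (S0) kit data of «SkelFrmQuasiBChoiceNums» (stmt-g33, G017) are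
N-parametrised — IN THIS FILE the readers `KS0.R'0/r₀0/r₀0_ge/base0/reach0 ↦ …N` resp. `KS.RA' ↦ KS.RAN'`, instantiated at `N := KS.NQ Φ = 13·max Φ.M 1`, nothing else.  Carrier-free
residents stay imported/exported from the original «SkelFrmBParamsClearF» exactly as in the FrmFrom port.  Docstrings and citations are the original's.

-/

noncomputable section

open scoped Classical

namespace Summit.CriticalPhenomena.PercolationContinuityZ3.Theorems.Transplant

namespace PlanarSkeletonFrmQuasi

namespace NegB

open Literature.Probability.Percolation Literature.Probability.LatticeModels SimpleGraph
open SkelConc (Consts)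
open Skelφ.StepI (DataN)
open Neg

namespace KS

section ClearF

/-- The recession of `N + 1 ≤ c` regions at `R′ ≤ RA′` per region is `≤ c·RA′`. [folklore] -/
theorem recession_le (κ : Consts) {V : Type} [DecidableEq V] [Countable V] {G : SimpleGraph V} [G.LocallyFinite] (Φ : PlanarSkeletonFrmQuasi G) (t : V) (p : unitInterval) (D : Skelφ.StepI.DataNS V) (c : ℕ) (mk : ℕ) {N : ℕ} {R's : ℕ} (hc : N + 1 ≤ c) (hR : R's ≤ KS0.R'0N κ Φ (KS.NQ Φ) t p D mk) : ((N : ℤ) + 1) * (R's : ℤ) ≤ (c : ℤ) * (KS0.R'0N κ Φ (KS.NQ Φ) t p D mk : ℤ) := by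
  have h : (N + 1) * R's ≤ c * KS0.R'0N κ Φ (KS.NQ Φ) t p D mk := Nat.mul_le_mul hc hR
  have h' : (((N + 1) * R's : ℕ) : ℤ) ≤ ((c * KS0.R'0N κ Φ (KS.NQ Φ) t p D mk : ℕ) : ℤ) := by exact_mod_cast h
  push_cast at h'
  linarith

/-- **The α-floor, case same** (`c_lo := n_L + nBF − RA′` = core 1's frame-α start, `mem_core1F_same_iff`): `M_u + n_L + (N+1)·R′ < c_lo` for
`N + 1 ≤ c`, `R′ ≤ RA′` — any `n_L`. [folklore] -/
theorem clearF_s (κ : Consts) {V : Type} [DecidableEq V] [Countable V] {G : SimpleGraph V} [G.LocallyFinite] (Φ : PlanarSkeletonFrmQuasi G) (t : V) (p : unitInterval) (D : Skelφ.StepI.DataNS V) (c : ℕ) (mk : ℕ) {N : ℕ} {R's : ℕ} (nL : ℕ) (hc : N + 1 ≤ c) (hR : R's ≤ KS0.R'0N κ Φ (KS.NQ Φ) t p D mk) :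
    ((Mu D : ℕ) : ℤ) + nL + ((N : ℤ) + 1) * (R's : ℤ) < (nL : ℤ) + nBF κ Φ t p D c mk - KS0.R'0N κ Φ (KS.NQ Φ) t p D mk := by
  have h1 := clearF κ Φ t p D c mk
  have h2 := recession_le κ Φ t p D c mk hc hR
  have h3 : (0 : ℤ) ≤ (KS0.R'0N κ Φ (KS.NQ Φ) t p D mk : ℤ) := by positivity
  nlinarith

-- GEN-Q (R-2, captain 2026-08-27): `PlanarSkeletonFrmFrom.NegB.KS.abs_hBF_ge_of_side` is not in the used cone of the node top — not ported.

-- GEN-Q (R-2, captain 2026-08-27): `PlanarSkeletonFrmFrom.NegB.KS.clearF_d` is not in the used cone of the node top — not ported.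

-- GEN-Q (R-2, captain 2026-08-27): `PlanarSkeletonFrmFrom.NegB.KS.sub_abs_hBF_ge_of_top` is not in the used cone of the node top — not ported.

-- GEN-Q (R-2, captain 2026-08-27): `PlanarSkeletonFrmFrom.NegB.KS.clearF_t` is not in the used cone of the node top — not ported.

end ClearF

end KS

end NegB

end PlanarSkeletonFrmQuasi

end Summit.CriticalPhenomena.PercolationContinuityZ3.Theorems.Transplant

end
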